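import Summits.ResolutionOfSingularities.ResolutionOfSingularities.Theorems.FrobeniusLadderFRationalResolutionVeroneseSingularLocus
import Summits.ResolutionOfSingularities.ResolutionOfSingularities.Theorems.FrobeniusLadderFRationalResolutionVeroneseExponentMonoid
import Summits.ResolutionOfSingularities.ResolutionOfSingularities.Theorems.FrobeniusLadderFRationalResolutionMonoidAlgebraFreeRegular
import Summits.ResolutionOfSingularities.ResolutionOfSingularities.Theorems.FrobeniusLadderFRationalResolutionConeCertificateGenerators
import Mathlib.Tactic.LinearCombination
import Mathlib.Tactic.Linarith
import Mathlib.Tactic.Ring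
import Mathlib.Tactic.FinCases
import HarnessLib

/-!
# Crux `FrobeniusLadder.FRationalResolution` (stmt-ResolutionOfSingularities-15317), line `redirect`,
# stub `stub_diagonalizableQuotientResolution` — THE `A₁` VERTEX CHART: face and vertex slots of the Veronese-presented cone monoid
# `Q = ⟨(2,0), (1,1), (0,2)⟩ ⊆ ℕ²` (item (β-cert) of MEMO-15317-leafhand2-g25 §3; reusable by every class with an `A₁` vertex chart)

The second disjunct of a vertex chart in `…ConeCertificateFreeChart.hasResolution_of_isolated_fixedPoints_of_mixedConeCertificate`
(p843969) asks, for the chart cone monoid `Q = ⟨G_Q⟩`, for the regularity of the faces `κ[Q][1/χᵍ]` (`g ∈ G_Q`) over every field and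
for the vertex certificate of the monomial algebra of `G_Q`. For the `A₁` cone presented as the Veronese monoid
`Q = ⟨{d ∈ ℕ² : |d| = 2}⟩` both slots are discharged here once and for all:

* faces: `κ[Q][1/χ^{(2,0)}] ≅ κ[ℕ × ℤ]`, `κ[Q][1/χ^{(0,2)}] ≅ κ[ℕ × ℤ]`, `κ[Q][1/χ^{(1,1)}] ≅ κ[ℤ²]` by explicit face maps
  (`…MonoidAlgebraAwayStructure.isRegularRing_away_iff_of_monoid` + `…MonoidAlgebraFreeRegular.isRegularRing_monoidAlgebra_of_addEquiv`,
  membership families by `…ConeCertificateGenerators`);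
* vertex: `veroneseCone_isRegular_affineBlowup K 2 2` VERBATIM (the slot's presentation is the Veronese one by `rfl`).

* ★★★ `veroneseTwo_chartSlots` — `G_Q` finite, `0 ∉ G_Q`, faces regular over every field, vertex certificate over every field.

Honest label: combinatorial helper toward ONE leaf stub (no stub, crux or summit closed). No definitions, no named facts, no sorry.
[folklore; cite: CoxLittleSchenck2011, §1.2, §10.1] [cite: Kollar2007, §2.2]
-/

noncomputable section

-- single-problem summit: the doubled namespace component is forced
set_option linter.dupNamespace false

open AlgebraicGeometry
open Literature.AlgebraicGeometry.Resolution

namespace Summit.ResolutionOfSingularities.ResolutionOfSingularities.Theorems.FRationalResolution.VeroneseTwoChart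

/-- The exponent of `p ∈ ℕⁿ` in `ℤⁿ`. -/
local notation3 (prettyPrint := false) "toZ[" n "]" =>
  (Finsupp.mapRange.addMonoidHom (Nat.castAddMonoidHom ℤ) : (Fin n →₀ ℕ) →+ (Fin n →₀ ℤ))

/-- The degree-2 exponents of `ℕ²`. -/
local notation3 (prettyPrint := false) "GQ2" => {d : Fin 2 →₀ ℕ | Finsupp.degree d = (2 : ℕ)}

/-- The Veronese monoid `⟨GQ2⟩ = {d : 2 ∣ |d|}`. -/
local notation3 (prettyPrint := false) "Q2" => AddSubmonoid.closure {d : Fin 2 →₀ ℕ | Finsupp.degree d = (2 : ℕ)}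

/-! ## §1 Face maps `ℕ × ℤ → ℤ²` and `ℤ² → ℤ²` -/

/-- A face map `ℕ × ℤ → ℤ²`, `(x; y) ↦ (a x + b y, c x + d y)` (existence form). [folklore] -/
theorem exists_faceHom₁ (a b c d : ℤ) :
    ∃ ι' : ((Fin 1 →₀ ℕ) × (Fin 1 →₀ ℤ)) →+ (Fin 2 →₀ ℤ), ∀ w,
      ι' w = Finsupp.single 0 (a * ((w.1 0 : ℕ) : ℤ) + b * w.2 0) + Finsupp.single 1 (c * ((w.1 0 : ℕ) : ℤ) + d * w.2 0) := by
  refine ⟨AddMonoidHom.mk' (fun w : (Fin 1 →₀ ℕ) × (Fin 1 →₀ ℤ) =>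
      (Finsupp.single 0 (a * ((w.1 0 : ℕ) : ℤ) + b * w.2 0) + Finsupp.single 1 (c * ((w.1 0 : ℕ) : ℤ) + d * w.2 0) :
        Fin 2 →₀ ℤ)) ?_, fun w => rfl⟩
  intro u w
  ext i
  simp only [Prod.fst_add, Prod.snd_add, Finsupp.coe_add, Pi.add_apply, Nat.cast_add, Finsupp.single_apply]
  split_ifs <;> ring

/-- A face map `ℤ² → ℤ²` (no `ℕ`-part), `(y₀, y₁) ↦ (a y₀ + b y₁, c y₀ + d y₁)` (existence form). [folklore] -/
theorem exists_faceHom₂ (a b c d : ℤ) :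
    ∃ ι' : ((Fin 0 →₀ ℕ) × (Fin 2 →₀ ℤ)) →+ (Fin 2 →₀ ℤ), ∀ w,
      ι' w = Finsupp.single 0 (a * w.2 0 + b * w.2 1) + Finsupp.single 1 (c * w.2 0 + d * w.2 1) := by
  refine ⟨AddMonoidHom.mk' (fun w : (Fin 0 →₀ ℕ) × (Fin 2 →₀ ℤ) =>
      (Finsupp.single 0 (a * w.2 0 + b * w.2 1) + Finsupp.single 1 (c * w.2 0 + d * w.2 1) : Fin 2 →₀ ℤ)) ?_, fun w => rfl⟩
  intro u w
  ext i
  simp only [Prod.snd_add, Finsupp.coe_add, Pi.add_apply, Finsupp.single_apply]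
  split_ifs <;> ring

/-- Coordinates of a vector written as `single 0 p + single 1 q`. [folklore] -/
theorem coord_eq (p q : ℤ) (z : Fin 2 →₀ ℤ) (h0 : p = z 0) (h1 : q = z 1) :
    (Finsupp.single 0 p + Finsupp.single 1 q : Fin 2 →₀ ℤ) = z := by
  ext i
  fin_cases i
  · simpa using h0
  · simpa using h1

/-- The two coordinates of `single 0 p + single 1 q`. [folklore] -/
theorem coord_apply (p q : ℤ) :
    (Finsupp.single 0 p + Finsupp.single 1 q : Fin 2 →₀ ℤ) 0 = p ∧ (Finsupp.single 0 p + Finsupp.single 1 q : Fin 2 →₀ ℤ) 1 = q := by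
  constructor <;> simp

/-- The exponent of a member of `ℕ²` in `ℤ²`, coordinatewise. [folklore] -/
theorem toZ_apply (m : Fin 2 →₀ ℕ) (i : Fin 2) : toZ[2] m i = (m i : ℤ) := by simp

/-! ## §2 The degree-2 exponents -/

/-- A degree-2 exponent of `ℕ²` is `(2,0)`, `(1,1)` or `(0,2)` (as coordinate values). [folklore] -/
theorem degree_two_cases (d : Fin 2 →₀ ℕ) (hd : Finsupp.degree d = 2) :
    (d 0 = 2 ∧ d 1 = 0) ∨ (d 0 = 1 ∧ d 1 = 1) ∨ (d 0 = 0 ∧ d 1 = 2) := by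
  rw [Finsupp.degree_eq_sum, Fin.sum_univ_two] at hd
  omega

/-- `GQ2` is finite. [folklore] -/
theorem gq2_finite : (GQ2).Finite :=
  Finsupp.finite_of_degree_le (σ := Fin 2) 2 |>.subset fun _ hd => le_of_eq hd

/-- `0 ∉ GQ2`. [folklore] -/
theorem zero_notMem_gq2 : (0 : Fin 2 →₀ ℕ) ∉ GQ2 := by
  intro h
  have h' : Finsupp.degree (0 : Fin 2 →₀ ℕ) = 2 := h
  rw [map_zero] at h'
  exact absurd h' (by norm_num)

/-! ## §3 The faces -/

/-- **The face of `Q2` at a degree-2 generator is regular over every field.** [folklore; cite: CoxLittleSchenck2011, §1.2] -/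
theorem face_regular (κ : Type) [Field κ] (u : ↥Q2) (hu : (u : Fin 2 →₀ ℕ) ∈ GQ2) :
    IsRegularRing (Localization.Away (AddMonoidAlgebra.single u (1 : κ))) := by
  -- membership in `Q2` = even degree
  have memQ : ∀ m : Fin 2 →₀ ℕ, m ∈ Q2 ↔ 2 ∣ m 0 + m 1 := fun m => by
    rw [MonomialAlgebraCompletion.mem_closure_degree_eq_iff, Finsupp.degree_eq_sum, Fin.sum_univ_two]
  have hu0 := toZ_apply (u : Fin 2 →₀ ℕ) 0
  have hu1 := toZ_apply (u : Fin 2 →₀ ℕ) 1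
  -- elements of `Q2` by coordinates
  have mkQ : ∀ s t : ℕ, 2 ∣ s + t → ∃ q : ↥Q2, ((q : Fin 2 →₀ ℕ) 0 = s ∧ (q : Fin 2 →₀ ℕ) 1 = t) := fun s t h =>
    ⟨⟨Finsupp.single 0 s + Finsupp.single 1 t, (memQ _).2 (by simpa using h)⟩, by simp, by simp⟩
  rcases degree_two_cases _ hu with ⟨e0, e1⟩ | ⟨e0, e1⟩ | ⟨e0, e1⟩
  · -- `u = (2,0)`: face monoid `ℕ × ℤ`, `(x; y) ↦ (x + 2y, x)`
    obtain ⟨ι', hι'⟩ := exists_faceHom₁ 1 2 1 0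
    have hap : ∀ w, ι' w 0 = ((w.1 0 : ℕ) : ℤ) + 2 * w.2 0 ∧ ι' w 1 = ((w.1 0 : ℕ) : ℤ) := fun w => by
      rw [hι']; refine ⟨by simp, by simp⟩
    have hinj : Function.Injective ι' := by
      intro w w' h
      obtain ⟨a0, a1⟩ := hap w
      obtain ⟨b0, b1⟩ := hap w'
      rw [h] at a0 a1
      have e₁ : ((w.1 0 : ℕ) : ℤ) = ((w'.1 0 : ℕ) : ℤ) := a1.symm.trans b1
      have e₂ : w.2 0 = w'.2 0 := by linarith [a0.symm.trans b0]
      refine Prod.ext ?_ ?_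
      · exact Finsupp.ext fun i => by fin_cases i; exact_mod_cast e₁
      · exact Finsupp.ext fun i => by fin_cases i; exact e₂
    have hM : ∀ w, ∃ (q : ↥Q2) (k : ℕ), ι' w + k • toZ[2] (u : Fin 2 →₀ ℕ) = toZ[2] (q : Fin 2 →₀ ℕ) := by
      refine ConeCertificateGenerators.face_forall_of_generators Q2 ι' (toZ[2] (u : Fin 2 →₀ ℕ))
        (fun q : ↥Q2 => toZ[2] (q : Fin 2 →₀ ℕ)) (by simp) (fun q q' => by rw [AddSubmonoid.coe_add, map_add]) _
        (ConeCertificateGenerators.closure_prodGenerators_eq_top 1 1) ?_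
      rintro t ((⟨i, rfl⟩ | ⟨j, rfl⟩) | ⟨j, rfl⟩)
      · fin_cases i
        obtain ⟨q, q0, q1⟩ := mkQ 1 1 (by norm_num)
        refine ⟨q, 0, ?_⟩
        rw [zero_smul, add_zero, hι']
        exact coord_eq _ _ _ (by simp [q0]) (by simp [q1])
      · fin_cases j
        refine ⟨u, 0, ?_⟩
        rw [zero_smul, add_zero, hι']
        exact coord_eq _ _ _ (by simp [e0]) (by simp [e1])
      · fin_cases j
        refine ⟨0, 1, ?_⟩
        rw [one_smul, hι']
        ext i; fin_cases i <;> simp [e0, e1]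
    have hQM : ∀ q : ↥Q2, ∃ w, ι' w = toZ[2] (q : Fin 2 →₀ ℕ) := by
      refine ConeCertificateGenerators.face_forall_exists_eq_of_generators Q2 ι' (toZ[2]) GQ2 rfl ?_
      intro q hq
      rcases degree_two_cases _ hq with ⟨q0, q1⟩ | ⟨q0, q1⟩ | ⟨q0, q1⟩
      · exact ⟨(0, Finsupp.single 0 1), by rw [hι']; exact coord_eq _ _ _ (by simp [q0]) (by simp [q1])⟩
      · exact ⟨(Finsupp.single 0 1, 0), by rw [hι']; exact coord_eq _ _ _ (by simp [q0]) (by simp [q1])⟩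
      · exact ⟨(Finsupp.single 0 2, -Finsupp.single 0 1), by
          rw [hι']; exact coord_eq _ _ _ (by simp [q0]) (by simp [q1])⟩
    have hgM : ∃ w₀, ι' w₀ + toZ[2] (u : Fin 2 →₀ ℕ) = 0 := by
      refine ⟨(0, -Finsupp.single 0 1), ?_⟩
      rw [hι']
      ext i; fin_cases i <;> simp [e0, e1]
    exact (MonoidAlgebraLaurent.isRegularRing_away_iff_of_monoid κ Q2 u ι' hinj hM hQM hgM).mpr
      (MonoidAlgebraLaurent.isRegularRing_monoidAlgebra_of_addEquiv κ (AddEquiv.refl _))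
  · -- `u = (1,1)` (interior): face monoid `ℤ²`, `(y₀, y₁) ↦ (2y₀ + y₁, y₁)`
    obtain ⟨ι', hι'⟩ := exists_faceHom₂ 2 1 0 1
    have hap : ∀ w, ι' w 0 = 2 * w.2 0 + w.2 1 ∧ ι' w 1 = w.2 1 := fun w => by
      rw [hι']; refine ⟨by simp, by simp⟩
    have hinj : Function.Injective ι' := by
      intro w w' h
      obtain ⟨a0, a1⟩ := hap w
      obtain ⟨b0, b1⟩ := hap w'
      rw [h] at a0 a1
      have e₂ : w.2 1 = w'.2 1 := a1.symm.trans b1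
      have e₁ : w.2 0 = w'.2 0 := by linarith [a0.symm.trans b0]
      refine Prod.ext ?_ ?_
      · exact Subsingleton.elim _ _
      · exact Finsupp.ext fun i => by fin_cases i; exacts [e₁, e₂]
    have hM : ∀ w, ∃ (q : ↥Q2) (k : ℕ), ι' w + k • toZ[2] (u : Fin 2 →₀ ℕ) = toZ[2] (q : Fin 2 →₀ ℕ) := by
      refine ConeCertificateGenerators.face_forall_of_generators Q2 ι' (toZ[2] (u : Fin 2 →₀ ℕ))
        (fun q : ↥Q2 => toZ[2] (q : Fin 2 →₀ ℕ)) (by simp) (fun q q' => by rw [AddSubmonoid.coe_add, map_add]) _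
        (ConeCertificateGenerators.closure_prodGenerators_eq_top 0 2) ?_
      rintro t ((⟨i, rfl⟩ | ⟨j, rfl⟩) | ⟨j, rfl⟩)
      · exact i.elim0
      · fin_cases j
        · obtain ⟨q, q0, q1⟩ := mkQ 2 0 (by norm_num)
          refine ⟨q, 0, ?_⟩
          rw [zero_smul, add_zero, hι']
          exact coord_eq _ _ _ (by simp [q0]) (by simp [q1])
        · refine ⟨u, 0, ?_⟩
          rw [zero_smul, add_zero, hι']
          exact coord_eq _ _ _ (by simp [e0]) (by simp [e1])
      · fin_cases j
        · obtain ⟨q, q0, q1⟩ := mkQ 0 2 (by norm_num)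
          refine ⟨q, 2, ?_⟩
          rw [hι']
          ext i; fin_cases i <;> simp [e0, e1, q0, q1]
        · refine ⟨0, 1, ?_⟩
          rw [one_smul, hι']
          ext i; fin_cases i <;> simp [e0, e1]
    have hQM : ∀ q : ↥Q2, ∃ w, ι' w = toZ[2] (q : Fin 2 →₀ ℕ) := by
      refine ConeCertificateGenerators.face_forall_exists_eq_of_generators Q2 ι' (toZ[2]) GQ2 rfl ?_
      intro q hq
      rcases degree_two_cases _ hq with ⟨q0, q1⟩ | ⟨q0, q1⟩ | ⟨q0, q1⟩
      · exact ⟨(0, Finsupp.single 0 1), by rw [hι']; exact coord_eq _ _ _ (by simp [q0]) (by simp [q1])⟩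
      · exact ⟨(0, Finsupp.single 1 1), by rw [hι']; exact coord_eq _ _ _ (by simp [q0]) (by simp [q1])⟩
      · exact ⟨(0, -Finsupp.single 0 1 + Finsupp.single 1 2), by
          rw [hι']; exact coord_eq _ _ _ (by simp [q0]) (by simp [q1])⟩
    have hgM : ∃ w₀, ι' w₀ + toZ[2] (u : Fin 2 →₀ ℕ) = 0 := by
      refine ⟨(0, -Finsupp.single 1 1), ?_⟩
      rw [hι']
      ext i; fin_cases i <;> simp [e0, e1]
    exact (MonoidAlgebraLaurent.isRegularRing_away_iff_of_monoid κ Q2 u ι' hinj hM hQM hgM).mpr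
      (MonoidAlgebraLaurent.isRegularRing_monoidAlgebra_of_addEquiv κ (AddEquiv.refl _))
  · -- `u = (0,2)`: face monoid `ℕ × ℤ`, `(x; y) ↦ (x, x + 2y)`
    obtain ⟨ι', hι'⟩ := exists_faceHom₁ 1 0 1 2
    have hap : ∀ w, ι' w 0 = ((w.1 0 : ℕ) : ℤ) ∧ ι' w 1 = ((w.1 0 : ℕ) : ℤ) + 2 * w.2 0 := fun w => by
      rw [hι']; refine ⟨by simp, by simp⟩
    have hinj : Function.Injective ι' := by
      intro w w' h
      obtain ⟨a0, a1⟩ := hap w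
      obtain ⟨b0, b1⟩ := hap w'
      rw [h] at a0 a1
      have e₁ : ((w.1 0 : ℕ) : ℤ) = ((w'.1 0 : ℕ) : ℤ) := a0.symm.trans b0
      have e₂ : w.2 0 = w'.2 0 := by linarith [a1.symm.trans b1]
      refine Prod.ext ?_ ?_
      · exact Finsupp.ext fun i => by fin_cases i; exact_mod_cast e₁
      · exact Finsupp.ext fun i => by fin_cases i; exact e₂
    have hM : ∀ w, ∃ (q : ↥Q2) (k : ℕ), ι' w + k • toZ[2] (u : Fin 2 →₀ ℕ) = toZ[2] (q : Fin 2 →₀ ℕ) := by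
      refine ConeCertificateGenerators.face_forall_of_generators Q2 ι' (toZ[2] (u : Fin 2 →₀ ℕ))
        (fun q : ↥Q2 => toZ[2] (q : Fin 2 →₀ ℕ)) (by simp) (fun q q' => by rw [AddSubmonoid.coe_add, map_add]) _
        (ConeCertificateGenerators.closure_prodGenerators_eq_top 1 1) ?_
      rintro t ((⟨i, rfl⟩ | ⟨j, rfl⟩) | ⟨j, rfl⟩)
      · fin_cases i
        obtain ⟨q, q0, q1⟩ := mkQ 1 1 (by norm_num)
        refine ⟨q, 0, ?_⟩
        rw [zero_smul, add_zero, hι']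
        exact coord_eq _ _ _ (by simp [q0]) (by simp [q1])
      · fin_cases j
        refine ⟨u, 0, ?_⟩
        rw [zero_smul, add_zero, hι']
        exact coord_eq _ _ _ (by simp [e0]) (by simp [e1])
      · fin_cases j
        refine ⟨0, 1, ?_⟩
        rw [one_smul, hι']
        ext i; fin_cases i <;> simp [e0, e1]
    have hQM : ∀ q : ↥Q2, ∃ w, ι' w = toZ[2] (q : Fin 2 →₀ ℕ) := by
      refine ConeCertificateGenerators.face_forall_exists_eq_of_generators Q2 ι' (toZ[2]) GQ2 rfl ?_
      intro q hq
      rcases degree_two_cases _ hq with ⟨q0, q1⟩ | ⟨q0, q1⟩ | ⟨q0, q1⟩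
      · exact ⟨(Finsupp.single 0 2, -Finsupp.single 0 1), by
          rw [hι']; exact coord_eq _ _ _ (by simp [q0]) (by simp [q1])⟩
      · exact ⟨(Finsupp.single 0 1, 0), by rw [hι']; exact coord_eq _ _ _ (by simp [q0]) (by simp [q1])⟩
      · exact ⟨(0, Finsupp.single 0 1), by rw [hι']; exact coord_eq _ _ _ (by simp [q0]) (by simp [q1])⟩
    have hgM : ∃ w₀, ι' w₀ + toZ[2] (u : Fin 2 →₀ ℕ) = 0 := by
      refine ⟨(0, -Finsupp.single 0 1), ?_⟩
      rw [hι']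
      ext i; fin_cases i <;> simp [e0, e1]
    exact (MonoidAlgebraLaurent.isRegularRing_away_iff_of_monoid κ Q2 u ι' hinj hM hQM hgM).mpr
      (MonoidAlgebraLaurent.isRegularRing_monoidAlgebra_of_addEquiv κ (AddEquiv.refl _))

/-! ## §4 The package -/

/-- ★★★ **THE SLOTS OF THE `A₁` VERTEX CHART.** For `G_Q = {d ∈ ℕ² : |d| = 2}` and `Q = ⟨G_Q⟩`: `G_Q` is finite, `0 ∉ G_Q`, every face
`κ[Q][1/χᵍ]` (`g ∈ G_Q`) is regular over every field, and the point blow-up of the Veronese cone `V(2,2)` is regular over every field —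
exactly the second disjunct of a vertex chart of `…ConeCertificateFreeChart.hasResolution_of_isolated_fixedPoints_of_mixedConeCertificate`
(with `AddSubmonoid.closure G_Q = Q` by `rfl`). [folklore; cite: CoxLittleSchenck2011, §10.1] [cite: Kollar2007, §2.2] -/
theorem veroneseTwo_chartSlots :
    (GQ2).Finite ∧ (0 : Fin 2 →₀ ℕ) ∉ GQ2 ∧
    (∀ (κ : Type) [Field κ], ∀ u : ↥Q2, (u : Fin 2 →₀ ℕ) ∈ GQ2 →
      IsRegularRing (Localization.Away (AddMonoidAlgebra.single u (1 : κ)))) ∧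
    (∀ (K : Type) [Field K], Scheme.IsRegular (affineBlowup (Ideal.span {w : ↥(Algebra.adjoin K
      ((fun d : Fin 2 →₀ ℕ => MvPolynomial.monomial d (1 : K)) '' GQ2)) |
      ∃ d ∈ GQ2, (w : MvPolynomial (Fin 2) K) = MvPolynomial.monomial d 1}))) :=
  ⟨gq2_finite, zero_notMem_gq2, fun κ _ u hu => face_regular κ u hu, fun K _ => veroneseCone_isRegular_affineBlowup K 2 2 (by norm_num)⟩

end Summit.ResolutionOfSingularities.ResolutionOfSingularities.Theorems.FRationalResolution.VeroneseTwoChart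

end
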